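import Literature.Analysis.UnboundedOperators.HeatKernelBoundedData
import Literature.Analysis.FunctionSpaces.TorusMollifierHolder
import Literature.Analysis.FunctionSpaces.FlatTorusProofs
import Literature.Analysis.FluidPDE.PressurePoisson
import HarnessLib

/-!
# Heat flow of periodic (torus) data: higher-order smoothing bounds and the mollified pressure gradient

Analysis/FluidPDE support file (all results proved; no definitions, no named facts). It serves
the discharge of the BDSV time-regularity step `Literature.Analysis.FluidPDE.BDSV.timeRegularity`
(`FluidPDE/OnsagerBDSV`; Buckmaster–De Lellis–Székelyhidi–Vicol 2019, §2.2), carried out in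
`FluidPDE/OnsagerBDSVProofs`, and continues `UnboundedOperators/HeatKernelBoundedData` (caloric
extension `e^{tΔ}g = heatExtension g t` of bounded data on a finite-dimensional inner product
space): here the data are periodic lifts `g̃ = Torus.lift g` of smooth functions on the flat torus
`T^d` to `ℝ^d = EuclideanSpace ℝ d`, which are bounded together with all their derivatives.

## Main results

* Lifts (`section Lift`): bounds for `g̃`, `Dg̃`, `D²g̃` of smooth torus functions
  (`exists_norm_lift_le`, `exists_norm_fderiv_lift_le`, `exists_norm_fderiv_fderiv_lift_le`), the
  identities `D g̃ = (Dg)~`, `∂ᵥ g̃ = (∂ᵥ g)~` (`fderiv_lift_eq`, `fderiv_lift_apply`), and the transfer of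
  Hölder increments `‖g̃ y - g̃ z‖ ≤ C ‖y - z‖^r` from `HolderWith C r g` on `T^d`
  (`norm_lift_sub_lift_le_of_holderWith`; the covering map is `1`-Lipschitz).
* Heat flow of lifted data (`section Heat`): derivatives fall on the data
  (`fderiv_heatExtension_lift_apply`), the semigroup law, the one-step smoothing bound
  `‖e^{(s+a)Δ}(∂ᵥψ)~‖₀ ≤ 2^{n/2} a^{-1/2} ‖e^{sΔ}ψ̃‖₀ ‖v‖` (`norm_heatExtension_lift_lineDeriv_le_step`)
  and its iterates: the **third-order smoothing bounds**
  `‖e^{3aΔ}(∂₁∂₂∂₃g)~‖₀ ≤ (2^{n/2}a^{-1/2})³ ‖g‖₀` and `≤ (2^{n/2}a^{-1/2})³ (1+2·2^{n/2})(2a)^{β/2}[g]_β`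
  (`norm_heatExtension_lift_lineDeriv₃_le_of_bound`, `…_of_holder`), i.e.
  `‖∇³ e^{σΔ} g‖₀ ≲ σ^{-3/2}‖g‖₀`, `≲ σ^{(β-3)/2}[g]_β` — obtained from the first-order bounds of
  `HeatKernelBoundedData` through `e^{σΔ} = e^{aΔ}e^{aΔ}e^{aΔ}`, with no new kernel computations;
  linearity on double sums of lifted data.
* `laplacian_fderiv_apply_comm`: `Δ ∂ᵥ ψ = ∂ᵥ Δ ψ` for `ψ ∈ C³` (Schwarz).
* `norm_heatExtension_le_integral_Ioi`: the tail representation bound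
  `‖e^{τΔ}h(x)‖ ≤ ∫_τ^∞ Θ` whenever `‖Δe^{σΔ}h(x)‖ ≤ Θ(σ)` and `e^{SΔ}h(x) → 0`
  (from `heatExtension_sub_eq_integral_laplacian` of `HeatFlowCalculus`).
* **`exists_norm_heatExtension_lift_lineDeriv_le_of_laplacian_eq`** — the mollified pressure-gradient
  bound replacing the Schauder step of BDSV §2.2: if `Δφ̃ = Σᵢⱼ ∂ᵢ∂ⱼF̃ᵢⱼ - Σᵢⱼ ∂ᵢ∂ⱼG̃ᵢⱼ` on `ℝ^d` with
  `|Fᵢⱼ| ≤ B` and `[Gᵢⱼ]_β ≤ A` (`0 ≤ β < 1`), then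
  `‖e^{τΔ}(∂ᵥφ)~(x)‖ ≤ (K_F B τ^{-1/2} + K_G A τ^{(β-1)/2}) ‖v‖` with constants depending only on
  `d, β`: `e^{τΔ}(∂ᵥφ)~ = -∫_τ^∞ e^{σΔ}(∂ᵥΔφ)~ dσ` and the third-order bounds at `σ = 3a`.

## Mathlib / tree search

Mathlib (this pin) has no heat semigroup and no symmetry of third derivatives beyond
`ContDiffAt.isSymmSndFDerivAt` (used twice here, as in `FluidPDE/PressurePoisson`). Tree: the
heat-kernel calculus is `UnboundedOperators/HeatKernel*`, `HeatFlowCalculus`,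
`HeatKernelBoundedData` (all reused); the torus glue is `FunctionSpaces/FlatTorus`,
`TorusCalculus(Proofs)`, `TorusMollifier` (`norm_proj_le`). Nothing is redefined.

## References

* T. Buckmaster, C. De Lellis, L. Székelyhidi Jr., V. Vicol, *Onsager's conjecture for admissible
  weak solutions*, CPAM 72 (2019) = arXiv:1701.08678, §2.2 (mollification and Schauder estimates
  in the time-regularity argument).
* M.-H. Giga, Y. Giga, J. Saal, *Nonlinear Partial Differential Equations* (2010), §1.1.3
  (derivative estimates for `e^{tΔ}`).
* L. C. Evans, *Partial Differential Equations*, 2nd ed. (2010), §2.3.1.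
-/

noncomputable section

open MeasureTheory Set Filter Topology InnerProductSpace
open Literature.Analysis.UnboundedOperators
open scoped Real ENNReal NNReal Laplacian ContDiff

namespace Literature.Analysis.FluidPDE

namespace TorusHeat

variable {d : Type*} [Fintype d]
variable {F : Type*} [NormedAddCommGroup F] [NormedSpace ℝ F]

/-! ## Periodic lifts: boundedness, derivatives, Hölder increments -/

section Lift

omit [Fintype d] [NormedSpace ℝ F] in
/-- A continuous function on the (compact) torus is bounded: `‖f z‖ ≤ C` with `0 ≤ C`. [folklore] -/
theorem exists_norm_le {f : UnitAddTorus d → F} (hf : Continuous f) :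
    ∃ C : ℝ, 0 ≤ C ∧ ∀ z, ‖f z‖ ≤ C := by
  obtain ⟨C, hC⟩ := isCompact_univ.exists_bound_of_continuousOn hf.continuousOn
  exact ⟨max C 0, le_max_right _ _, fun z => (hC _ (mem_univ _)).trans (le_max_left _ _)⟩

omit [Fintype d] [NormedSpace ℝ F] in
/-- A continuous function on the (compact) torus has a bounded lift: `‖f̃ y‖ ≤ C` with `0 ≤ C`.
[folklore] -/
theorem exists_norm_lift_le {f : UnitAddTorus d → F} (hf : Continuous f) :
    ∃ C : ℝ, 0 ≤ C ∧ ∀ y, ‖FunctionSpaces.Torus.lift f y‖ ≤ C := by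
  obtain ⟨C, hC0, hC⟩ := exists_norm_le hf
  exact ⟨C, hC0, fun y => hC _⟩

/-- The Fréchet derivative of the lift is the lift of the torus derivative (functional form of
`Torus.fderiv_lift`). [folklore] -/
theorem fderiv_lift_eq (f : UnitAddTorus d → F) :
    fderiv ℝ (FunctionSpaces.Torus.lift f) = FunctionSpaces.Torus.lift (FunctionSpaces.Torus.fderiv f) :=
  funext fun y => FunctionSpaces.Torus.fderiv_lift f y

/-- The torus derivative of a smooth function is smooth (its lift is `D` of the smooth lift).
[folklore] -/
theorem isSmooth_torusFderiv {f : UnitAddTorus d → F} (hf : FunctionSpaces.Torus.IsSmooth f) :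
    FunctionSpaces.Torus.IsSmooth (FunctionSpaces.Torus.fderiv f) := by
  unfold FunctionSpaces.Torus.IsSmooth
  rw [← fderiv_lift_eq]
  exact hf.fderiv_right le_rfl

/-- The directional derivative `∂ᵥ f̃ = (∂ᵥ f)~` of the lift of a smooth torus function is the
lift of the torus directional derivative (`Torus.lift_lineDeriv`, pointwise form). [folklore] -/
theorem fderiv_lift_apply {f : UnitAddTorus d → F} (hf : FunctionSpaces.Torus.IsSmooth f)
    (y v : EuclideanSpace ℝ d) :
    fderiv ℝ (FunctionSpaces.Torus.lift f) y v =
      FunctionSpaces.Torus.lift (fun x => FunctionSpaces.Torus.lineDeriv f x v) y := by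
  rw [FunctionSpaces.Torus.lift_lineDeriv (hf.isContDiff (by simp)) v]

/-- Functional form of `fderiv_lift_apply`. [folklore] -/
theorem fderiv_lift_apply_eq {f : UnitAddTorus d → F} (hf : FunctionSpaces.Torus.IsSmooth f)
    (v : EuclideanSpace ℝ d) :
    (fun y => fderiv ℝ (FunctionSpaces.Torus.lift f) y v) =
      FunctionSpaces.Torus.lift (fun x => FunctionSpaces.Torus.lineDeriv f x v) :=
  (FunctionSpaces.Torus.lift_lineDeriv (hf.isContDiff (by simp)) v).symm

/-- The lift of a smooth torus function has bounded derivative. [folklore] -/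
theorem exists_norm_fderiv_lift_le {f : UnitAddTorus d → F} (hf : FunctionSpaces.Torus.IsSmooth f) :
    ∃ C : ℝ, 0 ≤ C ∧ ∀ y, ‖fderiv ℝ (FunctionSpaces.Torus.lift f) y‖ ≤ C := by
  rw [fderiv_lift_eq]
  exact exists_norm_lift_le (isSmooth_torusFderiv hf).continuous

/-- The lift of a smooth torus function has bounded second derivative. [folklore] -/
theorem exists_norm_fderiv_fderiv_lift_le {f : UnitAddTorus d → F}
    (hf : FunctionSpaces.Torus.IsSmooth f) :
    ∃ C : ℝ, 0 ≤ C ∧ ∀ y, ‖fderiv ℝ (fderiv ℝ (FunctionSpaces.Torus.lift f)) y‖ ≤ C := by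
  rw [fderiv_lift_eq, fderiv_lift_eq]
  exact exists_norm_lift_le (isSmooth_torusFderiv (isSmooth_torusFderiv hf)).continuous

omit [NormedSpace ℝ F] in
/-- Hölder increments pass to the lift with the Euclidean distance: if `f` is `r`-Hölder with
constant `C` for the metric of `T^d`, then `‖f̃ y - f̃ z‖ ≤ C ‖y - z‖^r` on `ℝ^d` (the covering
map is `1`-Lipschitz, `Torus.norm_proj_le`). [folklore] -/
theorem norm_lift_sub_lift_le_of_holderWith {f : UnitAddTorus d → F} {C r : ℝ≥0}
    (hf : HolderWith C r f) (y z : EuclideanSpace ℝ d) :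
    ‖FunctionSpaces.Torus.lift f y - FunctionSpaces.Torus.lift f z‖ ≤ C * ‖y - z‖ ^ (r : ℝ) := by
  rw [FunctionSpaces.Torus.lift_apply, FunctionSpaces.Torus.lift_apply, ← dist_eq_norm]
  refine (hf.dist_le _ _).trans ?_
  have h : dist (FunctionSpaces.Torus.proj y) (FunctionSpaces.Torus.proj z) ≤ ‖y - z‖ := by
    rw [dist_eq_norm, ← FunctionSpaces.Torus.proj_sub]
    exact FunctionSpaces.Torus.norm_proj_le _
  gcongr

end Lift

/-! ## The heat flow of lifted torus data -/

section Heat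

variable [CompleteSpace F]

/-- **Derivatives fall on lifted smooth data**: `∂ᵥ(e^{tΔ} g̃)(x) = e^{tΔ}((∂ᵥ g)~)(x)` for a smooth
torus function `g` (`fderiv_heatExtension_apply_of_bounded`; the lift and its derivatives are
bounded). [folklore] -/
theorem fderiv_heatExtension_lift_apply {g : UnitAddTorus d → F} (hg : FunctionSpaces.Torus.IsSmooth g)
    {t : ℝ} (ht : 0 < t) (x v : EuclideanSpace ℝ d) :
    fderiv ℝ (heatExtension (FunctionSpaces.Torus.lift g) t) x v =
      heatExtension (FunctionSpaces.Torus.lift (fun z => FunctionSpaces.Torus.lineDeriv g z v)) t x := by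
  obtain ⟨C₀, -, hC₀⟩ := exists_norm_lift_le hg.continuous
  obtain ⟨C₁, -, hC₁⟩ := exists_norm_lift_le (hg.lineDeriv v).continuous
  rw [← fderiv_lift_apply_eq hg v] at hC₁ ⊢
  exact fderiv_heatExtension_apply_of_bounded (hg.isContDiff (by simp)) hC₀ hC₁ ht x

/-- The heat flow of lifted continuous data is smooth. [folklore] -/
theorem contDiff_heatExtension_lift {g : UnitAddTorus d → F} (hg : Continuous g) {t : ℝ}
    (ht : 0 < t) {m : ℕ∞} : ContDiff ℝ m (heatExtension (FunctionSpaces.Torus.lift g) t) := by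
  obtain ⟨C, -, hC⟩ := exists_norm_lift_le hg
  exact contDiff_heatExtension_of_bound (FunctionSpaces.Torus.continuous_lift_iff.2 hg) hC ht

omit [NormedSpace ℝ F] [CompleteSpace F] in
/-- Lifted continuous data are in `L^∞`. [folklore] -/
theorem memLp_top_lift {g : UnitAddTorus d → F} (hg : Continuous g) :
    MemLp (FunctionSpaces.Torus.lift g) ∞ (volume : Measure (EuclideanSpace ℝ d)) := by
  obtain ⟨C, -, hC⟩ := exists_norm_lift_le hg
  exact memLp_top_of_continuous_of_bound (FunctionSpaces.Torus.continuous_lift_iff.2 hg) hC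

/-- **Semigroup law on lifted continuous data**: `e^{aΔ}(e^{sΔ} g̃) = e^{(s+a)Δ} g̃`. [folklore] -/
theorem heatExtension_heatExtension_lift {g : UnitAddTorus d → F} (hg : Continuous g) {s a : ℝ}
    (hs : 0 < s) (ha : 0 < a) :
    heatExtension (heatExtension (FunctionSpaces.Torus.lift g) s) a =
      heatExtension (FunctionSpaces.Torus.lift g) (s + a) :=
  heatExtension_add_holds (memLp_top_lift hg) le_top hs ha

omit [CompleteSpace F] in
/-- Maximum principle on lifted data: `‖e^{tΔ} g̃ (x)‖ ≤ C` if `‖g‖ ≤ C`. [folklore] -/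
theorem norm_heatExtension_lift_le {g : UnitAddTorus d → F} {C : ℝ} (hC : ∀ z, ‖g z‖ ≤ C) {t : ℝ}
    (ht : 0 < t) (x : EuclideanSpace ℝ d) : ‖heatExtension (FunctionSpaces.Torus.lift g) t x‖ ≤ C :=
  norm_heatExtension_le (fun y => hC (FunctionSpaces.Torus.proj y)) ht x

/-- **One smoothing step.** If `‖e^{sΔ} ψ̃‖_∞ ≤ B` for a smooth torus function `ψ`, then
`‖e^{(s+a)Δ} (∂ᵥψ)~ (x)‖ ≤ 2^{n/2} a^{-1/2} B ‖v‖`: write `e^{(s+a)Δ}(∂ᵥψ)~ = ∂ᵥ e^{aΔ}(e^{sΔ}ψ̃)` and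
use the sup-norm gradient bound for bounded data (Giga–Giga–Saal 2010, §1.1.3). [cite: GigaGigaSaal2010, §1.1.3] -/
theorem norm_heatExtension_lift_lineDeriv_le_step {ψ : UnitAddTorus d → F}
    (hψ : FunctionSpaces.Torus.IsSmooth ψ) {s a B : ℝ} (hs : 0 < s) (ha : 0 < a)
    (hB : ∀ y, ‖heatExtension (FunctionSpaces.Torus.lift ψ) s y‖ ≤ B) (x v : EuclideanSpace ℝ d) :
    ‖heatExtension (FunctionSpaces.Torus.lift (fun z => FunctionSpaces.Torus.lineDeriv ψ z v)) (s + a) x‖ ≤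
      (2 : ℝ) ^ ((Module.finrank ℝ (EuclideanSpace ℝ d) : ℝ) / 2) * a ^ (-(1 / 2 : ℝ)) * B * ‖v‖ := by
  rw [← fderiv_heatExtension_lift_apply hψ (by linarith) x v, ← heatExtension_heatExtension_lift hψ.continuous hs ha]
  have hmeas : AEStronglyMeasurable (heatExtension (FunctionSpaces.Torus.lift ψ) s) volume :=
    (contDiff_heatExtension_lift hψ.continuous hs (m := 0)).continuous.aestronglyMeasurable
  exact norm_fderiv_heatExtension_apply_le_of_bounded hmeas hB ha x v

/-- Base case for bounded data: `‖e^{aΔ} (∂ᵥ g)~ (x)‖ ≤ 2^{n/2} a^{-1/2} B ‖v‖` if `‖g‖ ≤ B`.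
[cite: GigaGigaSaal2010, §1.1.3] -/
theorem norm_heatExtension_lift_lineDeriv_le_of_bound {g : UnitAddTorus d → F}
    (hg : FunctionSpaces.Torus.IsSmooth g) {B : ℝ} (hB : ∀ z, ‖g z‖ ≤ B) {a : ℝ} (ha : 0 < a)
    (x v : EuclideanSpace ℝ d) :
    ‖heatExtension (FunctionSpaces.Torus.lift (fun z => FunctionSpaces.Torus.lineDeriv g z v)) a x‖ ≤
      (2 : ℝ) ^ ((Module.finrank ℝ (EuclideanSpace ℝ d) : ℝ) / 2) * a ^ (-(1 / 2 : ℝ)) * B * ‖v‖ := by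
  rw [← fderiv_heatExtension_lift_apply hg ha x v]
  exact norm_fderiv_heatExtension_apply_le_of_bounded
    (FunctionSpaces.Torus.continuous_lift_iff.2 hg.continuous).aestronglyMeasurable (fun z => hB _) ha x v

/-- Base case for Hölder data: `‖e^{aΔ} (∂ᵥ g)~ (x)‖ ≤ 2^{n/2} a^{-1/2} (1+2·2^{n/2}) (2a)^{β/2} A ‖v‖`
if `‖g̃ y - g̃ z‖ ≤ A ‖y - z‖^β`, `0 ≤ β ≤ 1` (BDSV 2019, §2.2: `‖∇(f ⋆ ψ_ℓ)‖₀ ≲ [f]_β ℓ^{β-1}`).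
[cite: BuckmasterEtAl2018, §2.2 (standard mollification estimates)] -/
theorem norm_heatExtension_lift_lineDeriv_le_of_holder {g : UnitAddTorus d → F}
    (hg : FunctionSpaces.Torus.IsSmooth g) {A β : ℝ} (hA : 0 ≤ A) (hβ0 : 0 ≤ β) (hβ1 : β ≤ 1)
    (hH : ∀ y z, ‖FunctionSpaces.Torus.lift g y - FunctionSpaces.Torus.lift g z‖ ≤ A * ‖y - z‖ ^ β)
    {a : ℝ} (ha : 0 < a) (x v : EuclideanSpace ℝ d) :
    ‖heatExtension (FunctionSpaces.Torus.lift (fun z => FunctionSpaces.Torus.lineDeriv g z v)) a x‖ ≤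
      (2 : ℝ) ^ ((Module.finrank ℝ (EuclideanSpace ℝ d) : ℝ) / 2) * a ^ (-(1 / 2 : ℝ)) *
        ((1 + 2 * (2 : ℝ) ^ ((Module.finrank ℝ (EuclideanSpace ℝ d) : ℝ) / 2)) * (2 * a) ^ (β / 2)) * A * ‖v‖ := by
  obtain ⟨C, -, hC⟩ := exists_norm_lift_le hg.continuous
  rw [← fderiv_heatExtension_lift_apply hg ha x v]
  exact norm_fderiv_heatExtension_apply_le_of_holder
    (FunctionSpaces.Torus.continuous_lift_iff.2 hg.continuous) hC hA hβ0 hβ1 hH ha x v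

/-- **Third-order smoothing bound, bounded data**: for a smooth torus function `g` with `‖g‖ ≤ B`
and directions `v₁ v₂ v₃`,
`‖e^{3aΔ} (∂₁∂₂∂₃ g)~ (x)‖ ≤ (2^{n/2} a^{-1/2})³ B ‖v₁‖ ‖v₂‖ ‖v₃‖` (three smoothing steps through
`e^{3aΔ} = e^{aΔ}e^{aΔ}e^{aΔ}`). [cite: GigaGigaSaal2010, §1.1.3] -/
theorem norm_heatExtension_lift_lineDeriv₃_le_of_bound {g : UnitAddTorus d → F}
    (hg : FunctionSpaces.Torus.IsSmooth g) {B : ℝ} (hB : ∀ z, ‖g z‖ ≤ B) {a : ℝ} (ha : 0 < a)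
    (x v₁ v₂ v₃ : EuclideanSpace ℝ d) :
    ‖heatExtension (FunctionSpaces.Torus.lift (fun z => FunctionSpaces.Torus.lineDeriv
        (fun z' => FunctionSpaces.Torus.lineDeriv (fun z'' => FunctionSpaces.Torus.lineDeriv g z'' v₃) z' v₂) z v₁))
        (a + a + a) x‖ ≤
      (2 : ℝ) ^ ((Module.finrank ℝ (EuclideanSpace ℝ d) : ℝ) / 2) * a ^ (-(1 / 2 : ℝ)) * ((2 : ℝ) ^ ((Module.finrank ℝ (EuclideanSpace ℝ d) : ℝ) / 2) * a ^ (-(1 / 2 : ℝ)) *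
        ((2 : ℝ) ^ ((Module.finrank ℝ (EuclideanSpace ℝ d) : ℝ) / 2) * a ^ (-(1 / 2 : ℝ)) * B * ‖v₃‖) * ‖v₂‖) * ‖v₁‖ := by
  have h3 := hg.lineDeriv v₃
  have h23 := h3.lineDeriv v₂
  have haa : 0 < a + a := by linarith
  refine norm_heatExtension_lift_lineDeriv_le_step h23 haa ha (fun y => ?_) x v₁
  refine norm_heatExtension_lift_lineDeriv_le_step h3 ha ha (fun z => ?_) y v₂
  exact norm_heatExtension_lift_lineDeriv_le_of_bound hg hB ha z v₃

/-- **Third-order smoothing bound, Hölder data**: for a smooth torus function `g` with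
`‖g̃ y - g̃ z‖ ≤ A ‖y - z‖^β` (`0 ≤ β ≤ 1`) and directions `v₁ v₂ v₃`,
`‖e^{3aΔ} (∂₁∂₂∂₃ g)~ (x)‖ ≤ (2^{n/2} a^{-1/2})³ (1+2·2^{n/2}) (2a)^{β/2} A ‖v₁‖ ‖v₂‖ ‖v₃‖`, i.e.
`≲ a^{(β-3)/2} [g]_β`. [cite: BuckmasterEtAl2018, §2.2 (standard mollification estimates)] -/
theorem norm_heatExtension_lift_lineDeriv₃_le_of_holder {g : UnitAddTorus d → F}
    (hg : FunctionSpaces.Torus.IsSmooth g) {A β : ℝ} (hA : 0 ≤ A) (hβ0 : 0 ≤ β) (hβ1 : β ≤ 1)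
    (hH : ∀ y z, ‖FunctionSpaces.Torus.lift g y - FunctionSpaces.Torus.lift g z‖ ≤ A * ‖y - z‖ ^ β)
    {a : ℝ} (ha : 0 < a) (x v₁ v₂ v₃ : EuclideanSpace ℝ d) :
    ‖heatExtension (FunctionSpaces.Torus.lift (fun z => FunctionSpaces.Torus.lineDeriv
        (fun z' => FunctionSpaces.Torus.lineDeriv (fun z'' => FunctionSpaces.Torus.lineDeriv g z'' v₃) z' v₂) z v₁))
        (a + a + a) x‖ ≤
      (2 : ℝ) ^ ((Module.finrank ℝ (EuclideanSpace ℝ d) : ℝ) / 2) * a ^ (-(1 / 2 : ℝ)) * ((2 : ℝ) ^ ((Module.finrank ℝ (EuclideanSpace ℝ d) : ℝ) / 2) * a ^ (-(1 / 2 : ℝ)) *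
        ((2 : ℝ) ^ ((Module.finrank ℝ (EuclideanSpace ℝ d) : ℝ) / 2) * a ^ (-(1 / 2 : ℝ)) *
          ((1 + 2 * (2 : ℝ) ^ ((Module.finrank ℝ (EuclideanSpace ℝ d) : ℝ) / 2)) * (2 * a) ^ (β / 2)) * A * ‖v₃‖) * ‖v₂‖) * ‖v₁‖ := by
  have h3 := hg.lineDeriv v₃
  have h23 := h3.lineDeriv v₂
  have haa : 0 < a + a := by linarith
  refine norm_heatExtension_lift_lineDeriv_le_step h23 haa ha (fun y => ?_) x v₁
  refine norm_heatExtension_lift_lineDeriv_le_step h3 ha ha (fun z => ?_) y v₂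
  exact norm_heatExtension_lift_lineDeriv_le_of_holder hg hA hβ0 hβ1 hH ha z v₃

/-! ## Linearity of the heat flow on lifted data -/

omit [CompleteSpace F] in
/-- The heat flow of a double finite sum of lifted continuous data is the double sum of the heat
flows. [folklore] -/
theorem heatExtension_sum_sum_lift {g : d → d → UnitAddTorus d → F} (hg : ∀ i j, Continuous (g i j))
    {σ : ℝ} (hσ : 0 < σ) (x : EuclideanSpace ℝ d) :
    heatExtension (fun z => ∑ i, ∑ j, FunctionSpaces.Torus.lift (g i j) z) σ x =
      ∑ i, ∑ j, heatExtension (FunctionSpaces.Torus.lift (g i j)) σ x := by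
  choose C _ hC using fun i j => exists_norm_le (hg i j)
  rw [heatExtension_finset_sum _ _ _ (fun i _ => ?_)]
  · refine Finset.sum_congr rfl fun i _ => heatExtension_finset_sum _ _ _ (fun j _ => ?_)
    exact integrable_heatKernel_smul_of_bound (FunctionSpaces.Torus.continuous_lift_iff.2 (hg i j))
      (fun z => hC i j _) hσ x
  · exact integrable_heatKernel_smul_of_bound
      (continuous_finsetSum _ fun j _ => FunctionSpaces.Torus.continuous_lift_iff.2 (hg i j))
      (C := ∑ j, C i j) (fun z => (norm_sum_le _ _).trans (Finset.sum_le_sum fun j _ => hC i j _)) hσ x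

omit [CompleteSpace F] in
/-- The heat flow of a difference of two double sums of lifted continuous data. [folklore] -/
theorem heatExtension_sum_sum_lift_sub {g g' : d → d → UnitAddTorus d → F}
    (hg : ∀ i j, Continuous (g i j)) (hg' : ∀ i j, Continuous (g' i j)) {σ : ℝ} (hσ : 0 < σ)
    (x : EuclideanSpace ℝ d) :
    heatExtension (fun z => ∑ i, ∑ j, FunctionSpaces.Torus.lift (g i j) z -
        ∑ i, ∑ j, FunctionSpaces.Torus.lift (g' i j) z) σ x =
      ∑ i, ∑ j, heatExtension (FunctionSpaces.Torus.lift (g i j)) σ x -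
        ∑ i, ∑ j, heatExtension (FunctionSpaces.Torus.lift (g' i j)) σ x := by
  choose C _ hC using fun i j => exists_norm_le (hg i j)
  choose C' _ hC' using fun i j => exists_norm_le (hg' i j)
  have hc : ∀ {k : d → d → UnitAddTorus d → F}, (∀ i j, Continuous (k i j)) →
      Continuous fun z : EuclideanSpace ℝ d => ∑ i, ∑ j, FunctionSpaces.Torus.lift (k i j) z :=
    fun hk => continuous_finsetSum _ fun i _ => continuous_finsetSum _ fun j _ =>
      FunctionSpaces.Torus.continuous_lift_iff.2 (hk i j)
  have hb : ∀ {k : d → d → UnitAddTorus d → F} {K : d → d → ℝ}, (∀ i j z, ‖k i j z‖ ≤ K i j) →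
      ∀ z : EuclideanSpace ℝ d, ‖∑ i, ∑ j, FunctionSpaces.Torus.lift (k i j) z‖ ≤ ∑ i, ∑ j, K i j :=
    fun hk z => (norm_sum_le _ _).trans (Finset.sum_le_sum fun i _ =>
      (norm_sum_le _ _).trans (Finset.sum_le_sum fun j _ => hk i j _))
  rw [heatExtension_sub_of_bound (hc hg) (hc hg') (hb hC) (hb hC') hσ x,
    heatExtension_sum_sum_lift hg hσ x, heatExtension_sum_sum_lift hg' hσ x]

omit [CompleteSpace F] in
/-- Second directional derivatives of lifts: `∂ᵤ ∂_w g̃ = (∂ᵤ ∂_w g)~`. [folklore] -/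
theorem fderiv_fderiv_lift_apply {g : UnitAddTorus d → F} (hg : FunctionSpaces.Torus.IsSmooth g)
    (y u w : EuclideanSpace ℝ d) :
    fderiv ℝ (fun z => fderiv ℝ (FunctionSpaces.Torus.lift g) z w) y u =
      FunctionSpaces.Torus.lift (fun x => FunctionSpaces.Torus.lineDeriv
        (fun x' => FunctionSpaces.Torus.lineDeriv g x' w) x u) y := by
  rw [fderiv_lift_apply_eq hg w, fderiv_lift_apply (hg.lineDeriv w)]

omit [CompleteSpace F] in
/-- The directional derivative of a double sum of lifted smooth data is the double sum of the
lifted directional derivatives. [folklore] -/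
theorem fderiv_sum_sum_lift_apply {g : d → d → UnitAddTorus d → F}
    (hg : ∀ i j, FunctionSpaces.Torus.IsSmooth (g i j)) (y v : EuclideanSpace ℝ d) :
    fderiv ℝ (fun z => ∑ i, ∑ j, FunctionSpaces.Torus.lift (g i j) z) y v =
      ∑ i, ∑ j, FunctionSpaces.Torus.lift (fun x => FunctionSpaces.Torus.lineDeriv (g i j) x v) y := by
  have hd : ∀ i j, DifferentiableAt ℝ (FunctionSpaces.Torus.lift (g i j)) y := fun i j =>
    ((hg i j).isContDiff (n := 1) (by simp)).differentiable one_ne_zero y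
  have hdi : ∀ i, DifferentiableAt ℝ (fun z => ∑ j, FunctionSpaces.Torus.lift (g i j) z) y := fun i =>
    DifferentiableAt.fun_sum fun j _ => hd i j
  rw [fderiv_fun_sum fun i _ => hdi i, _root_.FunLike.coe_sum, Finset.sum_apply]
  refine Finset.sum_congr rfl fun i _ => ?_
  rw [fderiv_fun_sum fun j _ => hd i j, _root_.FunLike.coe_sum, Finset.sum_apply]
  exact Finset.sum_congr rfl fun j _ => fderiv_lift_apply (hg i j) y v

omit [CompleteSpace F] in
/-- The double sum of lifted smooth data is differentiable. [folklore] -/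
theorem differentiableAt_sum_sum_lift {g : d → d → UnitAddTorus d → F}
    (hg : ∀ i j, FunctionSpaces.Torus.IsSmooth (g i j)) (y : EuclideanSpace ℝ d) :
    DifferentiableAt ℝ (fun z => ∑ i, ∑ j, FunctionSpaces.Torus.lift (g i j) z) y :=
  DifferentiableAt.fun_sum fun i _ => DifferentiableAt.fun_sum fun j _ =>
    ((hg i j).isContDiff (n := 1) (by simp)).differentiable one_ne_zero y

end Heat

/-! ## The Laplacian commutes with directional derivatives -/

section LaplacianComm

variable {E' : Type*} [NormedAddCommGroup E'] [InnerProductSpace ℝ E'] [FiniteDimensional ℝ E']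

/-- **`Δ ∂ᵥ ψ = ∂ᵥ Δ ψ`** for `ψ ∈ C³` (Schwarz's theorem for `D²ψ` and `D³ψ`). [folklore] -/
theorem laplacian_fderiv_apply_comm {ψ : E' → ℝ} (hψ : ContDiff ℝ 3 ψ) (y v : E') :
    (Δ (fun z => fderiv ℝ ψ z v)) y = fderiv ℝ (Δ ψ) y v := by
  set b := stdOrthonormalBasis ℝ E'
  set D1 : E' → E' →L[ℝ] ℝ := fderiv ℝ ψ with hD1_def
  set D2 : E' → E' →L[ℝ] E' →L[ℝ] ℝ := fderiv ℝ D1 with hD2_def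
  set D3 : E' → E' →L[ℝ] E' →L[ℝ] E' →L[ℝ] ℝ := fderiv ℝ D2 with hD3_def
  have hD1 : ContDiff ℝ 2 D1 := hψ.fderiv_right (m := 2) le_rfl
  have hD2 : ContDiff ℝ 1 D2 := hD1.fderiv_right (m := 1) le_rfl
  have hD1d : Differentiable ℝ D1 := hD1.differentiable two_ne_zero
  have hD2d : Differentiable ℝ D2 := hD2.differentiable one_ne_zero
  have h23 : minSmoothness ℝ 2 ≤ (3 : ℕ∞ω) := by
    rw [minSmoothness_of_isRCLikeNormedField]
    exact_mod_cast (show (2 : ℕ) ≤ 3 by norm_num)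
  have h22 : minSmoothness ℝ 2 ≤ (2 : ℕ∞ω) := by
    rw [minSmoothness_of_isRCLikeNormedField]
  have hS2 : ∀ z a c, D2 z a c = D2 z c a := fun z a c =>
    (hψ.contDiffAt.isSymmSndFDerivAt h23).eq a c
  have hS3 : ∀ a c, D3 y a c = D3 y c a := fun a c =>
    (hD1.contDiffAt.isSymmSndFDerivAt h22).eq a c
  have hS3' : ∀ a c e, D3 y a c e = D3 y a e c := fun a c e => by
    have h1 : (fun z => D2 z c e) = fun z => D2 z e c := funext fun z => hS2 z c e
    have h2 : ∀ c e, fderiv ℝ (fun z => D2 z c e) y a = D3 y a c e := fun c e => by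
      have hce : DifferentiableAt ℝ (fun z => D2 z c) y :=
        (hD2d y).clm_apply (differentiableAt_const _)
      rw [fderiv_apply_const_apply hce, fderiv_apply_const_apply (hD2d y)]
    rw [← h2 c e, h1, h2 e c]
  -- left-hand side
  have hdv : ContDiff ℝ 2 (fun z => D1 z v) := hD1.clm_apply contDiff_const
  have hL : ∀ i, fderiv ℝ (fun z => fderiv ℝ (fun w => D1 w v) z (b i)) y (b i) = D3 y (b i) (b i) v := by
    intro i
    have hfun : (fun z => fderiv ℝ (fun w => D1 w v) z (b i)) = fun z => D2 z (b i) v :=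
      funext fun z => fderiv_apply_const_apply (hD1d z) v (b i)
    have hG : DifferentiableAt ℝ (fun z => D2 z (b i)) y :=
      (hD2d y).clm_apply (differentiableAt_const _)
    rw [hfun, fderiv_apply_const_apply hG, fderiv_apply_const_apply (hD2d y)]
  -- right-hand side
  have hΔ : (Δ ψ) = fun z => ∑ i, D2 z (b i) (b i) := by
    funext z
    rw [laplacian_eq_sum_fderiv_fderiv b (hψ.of_le (by norm_num)) z]
    exact Finset.sum_congr rfl fun i _ => fderiv_apply_const_apply (hD1d z) _ _
  have hR : fderiv ℝ (Δ ψ) y v = ∑ i, D3 y v (b i) (b i) := by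
    have hdi : ∀ i, DifferentiableAt ℝ (fun z => D2 z (b i)) y := fun i =>
      (hD2d y).clm_apply (differentiableAt_const _)
    rw [hΔ, fderiv_fun_sum fun i _ => (hdi i).clm_apply (differentiableAt_const _),
      _root_.FunLike.coe_sum, Finset.sum_apply]
    refine Finset.sum_congr rfl fun i _ => ?_
    rw [fderiv_apply_const_apply (hdi i), fderiv_apply_const_apply (hD2d y)]
  rw [laplacian_eq_sum_fderiv_fderiv b hdv y, hR]
  refine Finset.sum_congr rfl fun i _ => ?_
  rw [hL i, hS3 v (b i), hS3' (b i) v (b i)]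

end LaplacianComm

/-! ## Representation from infinity and the pressure-type bound -/

section Pressure

omit [Fintype d] in
/-- **Tail representation bound.** For `h ∈ L^∞(ℝ^d)` with `‖e^{SΔ}h(x)‖ → 0` as `S → ∞` and
`‖Δ e^{σΔ} h (x)‖ ≤ Θ(σ)` for `σ > τ` with `Θ` integrable on `(τ, ∞)`:
`‖e^{τΔ} h (x)‖ ≤ ∫_τ^∞ Θ` (from `e^{SΔ}h - e^{τΔ}h = ∫_τ^S Δe^{σΔ}h dσ`,
`heatExtension_sub_eq_integral_laplacian`). [folklore] -/
theorem norm_heatExtension_le_integral_Ioi [Fintype d] [CompleteSpace F] {h : EuclideanSpace ℝ d → F}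
    (hh : MemLp h ∞ (volume : Measure (EuclideanSpace ℝ d))) {τ : ℝ} (hτ : 0 < τ)
    (x : EuclideanSpace ℝ d) {Θ : ℝ → ℝ} (hΘi : IntegrableOn Θ (Ioi τ))
    (hΘ : ∀ σ, τ < σ → ‖(Δ (heatExtension h σ)) x‖ ≤ Θ σ)
    (hdecay : ∀ ε, 0 < ε → ∀ᶠ S in atTop, ‖heatExtension h S x‖ ≤ ε) :
    ‖heatExtension h τ x‖ ≤ ∫ σ in Ioi τ, Θ σ := by
  refine le_of_forall_pos_le_add fun ε hε => ?_
  obtain ⟨S, hS, hSτ⟩ := ((hdecay ε hε).and (eventually_ge_atTop τ)).exists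
  have hFTC := heatExtension_sub_eq_integral_laplacian hh le_top hτ hSτ x
  have hΘnn : ∀ σ, τ < σ → 0 ≤ Θ σ := fun σ hσ => (norm_nonneg _).trans (hΘ σ hσ)
  have h1 : ‖∫ σ in τ..S, (Δ (heatExtension h σ)) x‖ ≤ ∫ σ in Ioi τ, Θ σ := by
    rw [intervalIntegral.integral_of_le hSτ]
    calc ‖∫ σ in Ioc τ S, (Δ (heatExtension h σ)) x‖ ≤ ∫ σ in Ioc τ S, Θ σ :=
          norm_integral_le_of_norm_le (f := fun σ => (Δ (heatExtension h σ)) x)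
            (hΘi.mono_set Ioc_subset_Ioi_self)
            ((ae_restrict_iff' measurableSet_Ioc).2 (Eventually.of_forall fun σ hσ => hΘ σ hσ.1))
      _ ≤ ∫ σ in Ioi τ, Θ σ := setIntegral_mono_set hΘi
            ((ae_restrict_iff' measurableSet_Ioi).2 (Eventually.of_forall fun σ hσ => hΘnn σ hσ))
            Ioc_subset_Ioi_self.eventuallyLE
  calc ‖heatExtension h τ x‖
      = ‖heatExtension h S x - (heatExtension h S x - heatExtension h τ x)‖ := by rw [sub_sub_cancel]
    _ ≤ ‖heatExtension h S x‖ + ‖heatExtension h S x - heatExtension h τ x‖ := norm_sub_le _ _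
    _ ≤ ε + ∫ σ in Ioi τ, Θ σ := add_le_add hS (by rw [hFTC]; exact h1)
    _ = (∫ σ in Ioi τ, Θ σ) + ε := add_comm _ _

variable [CompleteSpace F]

/-- Decay at infinity of the heat flow of a lifted *derivative*:
`‖e^{SΔ} (∂ᵥ φ)~ (x)‖ ≤ 2^{n/2} S^{-1/2} ‖φ‖_∞ ‖v‖ → 0`. [folklore] -/
theorem eventually_norm_heatExtension_lift_lineDeriv_le {φ : UnitAddTorus d → F}
    (hφ : FunctionSpaces.Torus.IsSmooth φ) (x v : EuclideanSpace ℝ d) {ε : ℝ} (hε : 0 < ε) :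
    ∀ᶠ S in atTop,
      ‖heatExtension (FunctionSpaces.Torus.lift (fun z => FunctionSpaces.Torus.lineDeriv φ z v)) S x‖ ≤ ε := by
  obtain ⟨C, -, hC⟩ := exists_norm_le hφ.continuous
  set c : ℝ := (2 : ℝ) ^ ((Module.finrank ℝ (EuclideanSpace ℝ d) : ℝ) / 2) with hc
  have ht : Tendsto (fun S : ℝ => c * S ^ (-(1 / 2 : ℝ)) * C * ‖v‖) atTop (𝓝 0) := by
    have h1 := tendsto_rpow_neg_atTop (y := (1 / 2 : ℝ)) (by norm_num)
    have h2 : Tendsto (fun S : ℝ => c * S ^ (-(1 / 2 : ℝ)) * C * ‖v‖) atTop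
        (𝓝 (c * 0 * C * ‖v‖)) := ((h1.const_mul _).mul_const _).mul_const _
    simpa using h2
  filter_upwards [(tendsto_order.1 ht).2 ε hε, eventually_gt_atTop 0] with S hS hS0
  exact (norm_heatExtension_lift_lineDeriv_le_of_bound hφ hC hS0 x v).trans hS.le

/-- The Laplacian of the heat flow of lifted smooth data: `Δ(e^{σΔ} g̃)(x) = e^{σΔ}(Δ g̃)(x)`.
[folklore] -/
theorem laplacian_heatExtension_lift {g : UnitAddTorus d → F} (hg : FunctionSpaces.Torus.IsSmooth g)
    {σ : ℝ} (hσ : 0 < σ) (x : EuclideanSpace ℝ d) :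
    (Δ (heatExtension (FunctionSpaces.Torus.lift g) σ)) x =
      heatExtension (Δ (FunctionSpaces.Torus.lift g)) σ x := by
  obtain ⟨C₀, -, h0⟩ := exists_norm_lift_le hg.continuous
  obtain ⟨C₁, -, h1⟩ := exists_norm_fderiv_lift_le hg
  obtain ⟨C₂, -, h2⟩ := exists_norm_fderiv_fderiv_lift_le hg
  exact laplacian_heatExtension_of_bounded (contDiff_infty.1 hg 2) h0 h1 h2 hσ x

/-- `((σ/3)^{-1/2})³ = 3^{3/2} σ^{-3/2}`. [folklore] -/
theorem rpow_div_three_aux {σ : ℝ} (hσ : 0 < σ) :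
    ((σ / 3) ^ (-(1 / 2 : ℝ))) ^ 3 = (3 : ℝ) ^ ((3 : ℝ) / 2) * σ ^ (-(3 / 2 : ℝ)) := by
  have h3 : (0 : ℝ) ≤ 3 := by norm_num
  rw [← Real.rpow_natCast, ← Real.rpow_mul (by positivity)]
  rw [show (-(1 / 2 : ℝ)) * ((3 : ℕ) : ℝ) = -(3 / 2 : ℝ) by norm_num,
    Real.div_rpow hσ.le h3, Real.rpow_neg h3, div_inv_eq_mul, mul_comm]

/-- `(2(σ/3))^{β/2} ((σ/3)^{-1/2})³ = (2^{β/2}/3^{β/2} · 3^{3/2}) σ^{(β-3)/2}`. [folklore] -/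
theorem rpow_div_three_aux' {σ : ℝ} (hσ : 0 < σ) (β : ℝ) :
    (2 * (σ / 3)) ^ (β / 2) * ((σ / 3) ^ (-(1 / 2 : ℝ))) ^ 3 =
      ((2 : ℝ) ^ (β / 2) / (3 : ℝ) ^ (β / 2) * (3 : ℝ) ^ ((3 : ℝ) / 2)) * σ ^ ((β - 3) / 2) := by
  have h3 : (0 : ℝ) ≤ 3 := by norm_num
  rw [rpow_div_three_aux hσ, Real.mul_rpow (by norm_num) (by positivity), Real.div_rpow hσ.le h3,
    show (β - 3) / 2 = β / 2 + -(3 / 2 : ℝ) by ring, Real.rpow_add hσ]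
  field_simp

/-- **The mollified pressure-gradient bound** (BDSV 2019, §2.2, the Schauder step, here via the
heat kernel). Let `φ, Fᵢⱼ, Gᵢⱼ` be smooth on `T^d` with `|Fᵢⱼ| ≤ B`, `[Gᵢⱼ]_β ≤ A` (increments of the
lifts, `0 ≤ β < 1`) and `Δφ̃ = Σᵢⱼ ∂ᵢ∂ⱼ F̃ᵢⱼ - Σᵢⱼ ∂ᵢ∂ⱼ G̃ᵢⱼ` on `ℝ^d` (the pressure equation
`Δp = div div (R̊ - v ⊗ v)`). Then for every `τ > 0`, direction `v` and point `x`,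
`‖e^{τΔ} (∂ᵥφ)~ (x)‖ ≤ (K_F B τ^{-1/2} + K_G A τ^{(β-1)/2}) ‖v‖`, i.e.
`‖∇p ⋆ ψ_ℓ‖₀ ≲ ‖R̊‖₀ ℓ^{-1} + [v⊗v]_β ℓ^{β-1}` at `ℓ = √τ`. Proof: `e^{τΔ}(∂ᵥφ)~ = -∫_τ^∞ e^{σΔ}(∂ᵥΔφ)~ dσ`
and the third-order smoothing bounds at `σ = 3a`. [cite: BuckmasterEtAl2018, §2.2 (proof of Thm. 1.1, time regularity)] -/
theorem exists_norm_heatExtension_lift_lineDeriv_le_of_laplacian_eq (d : Type*) [Fintype d]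
    [DecidableEq d] {β : ℝ} (hβ0 : 0 ≤ β) (hβ1 : β < 1) :
    ∃ KF KG : ℝ, 0 ≤ KF ∧ 0 ≤ KG ∧
      ∀ {φ : UnitAddTorus d → ℝ} (_hφ : FunctionSpaces.Torus.IsSmooth φ)
        {Fs Gs : d → d → UnitAddTorus d → ℝ} (_hF : ∀ i j, FunctionSpaces.Torus.IsSmooth (Fs i j))
        (_hG : ∀ i j, FunctionSpaces.Torus.IsSmooth (Gs i j)) {B : ℝ} (_hB : ∀ i j z, ‖Fs i j z‖ ≤ B)
        {A : ℝ} (_hA : 0 ≤ A)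
        (_hH : ∀ i j y z, ‖FunctionSpaces.Torus.lift (Gs i j) y - FunctionSpaces.Torus.lift (Gs i j) z‖ ≤
          A * ‖y - z‖ ^ β)
        (_hΔ : ∀ y, (Δ (FunctionSpaces.Torus.lift φ)) y =
          ∑ i, ∑ j, fderiv ℝ (fun z => fderiv ℝ (FunctionSpaces.Torus.lift (Fs i j)) z
            (EuclideanSpace.single j (1 : ℝ))) y (EuclideanSpace.single i (1 : ℝ)) -
          ∑ i, ∑ j, fderiv ℝ (fun z => fderiv ℝ (FunctionSpaces.Torus.lift (Gs i j)) z
            (EuclideanSpace.single j (1 : ℝ))) y (EuclideanSpace.single i (1 : ℝ)))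
        {τ : ℝ} (_hτ : 0 < τ) (x v : EuclideanSpace ℝ d),
        ‖heatExtension (FunctionSpaces.Torus.lift (fun z => FunctionSpaces.Torus.lineDeriv φ z v)) τ x‖ ≤
          (KF * B * τ ^ (-(1 / 2 : ℝ)) + KG * A * τ ^ ((β - 1) / 2)) * ‖v‖ := by
  -- the constants
  set c : ℝ := (2 : ℝ) ^ ((Module.finrank ℝ (EuclideanSpace ℝ d) : ℝ) / 2) with hc
  set cH : ℝ := (1 + 2 * (2 : ℝ) ^ ((Module.finrank ℝ (EuclideanSpace ℝ d) : ℝ) / 2)) with hcH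
  have hc0 : 0 < c := Real.rpow_pos_of_pos two_pos _
  have hcH0 : 0 < cH := by rw [hcH]; positivity
  set KF : ℝ := (Fintype.card d : ℝ) ^ 2 * c ^ 3 * (3 : ℝ) ^ ((3 : ℝ) / 2) * 2 with hKF
  set KG : ℝ := (Fintype.card d : ℝ) ^ 2 * c ^ 3 * cH *
    ((2 : ℝ) ^ (β / 2) / (3 : ℝ) ^ (β / 2) * (3 : ℝ) ^ ((3 : ℝ) / 2)) * (2 / (1 - β)) with hKG
  have h1β0 : 0 < 1 - β := by linarith
  refine ⟨KF, KG, by positivity, by positivity, ?_⟩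
  intro φ hφ Fs Gs hF hG B hB A hA hH hΔ τ hτ x v
  -- notation
  obtain ⟨e, he_def⟩ : ∃ e : d → EuclideanSpace ℝ d, ∀ i, e i = EuclideanSpace.single i (1 : ℝ) :=
    ⟨_, fun _ => rfl⟩
  have he : ∀ i, ‖e i‖ = 1 := fun i => by rw [he_def]; simp
  set D : EuclideanSpace ℝ d → (UnitAddTorus d → ℝ) → UnitAddTorus d → ℝ :=
    fun w g z => FunctionSpaces.Torus.lineDeriv g z w with hD_def
  have hDs : ∀ {g : UnitAddTorus d → ℝ}, FunctionSpaces.Torus.IsSmooth g → ∀ w,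
      FunctionSpaces.Torus.IsSmooth (D w g) := fun hg w => hg.lineDeriv w
  -- the third derivatives entering `∂ᵥ Δ φ`
  set F3 : d → d → UnitAddTorus d → ℝ := fun i j => D v (D (e i) (D (e j) (Fs i j))) with hF3_def
  set G3 : d → d → UnitAddTorus d → ℝ := fun i j => D v (D (e i) (D (e j) (Gs i j))) with hG3_def
  have hF3 : ∀ i j, FunctionSpaces.Torus.IsSmooth (F3 i j) := fun i j =>
    hDs (hDs (hDs (hF i j) _) _) _
  have hG3 : ∀ i j, FunctionSpaces.Torus.IsSmooth (G3 i j) := fun i j =>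
    hDs (hDs (hDs (hG i j) _) _) _
  -- the datum `g = ∂ᵥ φ` and its Laplacian
  set g : UnitAddTorus d → ℝ := D v φ with hg_def
  have hg : FunctionSpaces.Torus.IsSmooth g := hDs hφ v
  have hΔg : Δ (FunctionSpaces.Torus.lift g) = fun y =>
      ∑ i, ∑ j, FunctionSpaces.Torus.lift (F3 i j) y - ∑ i, ∑ j, FunctionSpaces.Torus.lift (G3 i j) y := by
    have hF2 : ∀ i j, FunctionSpaces.Torus.IsSmooth (D (e i) (D (e j) (Fs i j))) := fun i j =>
      hDs (hDs (hF i j) _) _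
    have hG2 : ∀ i j, FunctionSpaces.Torus.IsSmooth (D (e i) (D (e j) (Gs i j))) := fun i j =>
      hDs (hDs (hG i j) _) _
    have hΔφ : Δ (FunctionSpaces.Torus.lift φ) = fun y =>
        ∑ i, ∑ j, FunctionSpaces.Torus.lift (D (e i) (D (e j) (Fs i j))) y -
        ∑ i, ∑ j, FunctionSpaces.Torus.lift (D (e i) (D (e j) (Gs i j))) y := by
      funext y
      rw [hΔ y]
      simp only [← he_def, fderiv_fderiv_lift_apply (hF _ _), fderiv_fderiv_lift_apply (hG _ _)]
      rfl
    funext y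
    rw [hg_def, hD_def]
    dsimp only
    rw [← fderiv_lift_apply_eq hφ v, laplacian_fderiv_apply_comm (contDiff_infty.1 hφ 3) y v, hΔφ,
      fderiv_fun_sub (differentiableAt_sum_sum_lift hF2 y) (differentiableAt_sum_sum_lift hG2 y),
      _root_.FunLike.coe_sub, Pi.sub_apply, fderiv_sum_sum_lift_apply hF2,
      fderiv_sum_sum_lift_apply hG2]
  -- pointwise bound on `Δ e^{σΔ} g̃`
  set Θ : ℝ → ℝ := fun σ =>
    ((Fintype.card d : ℝ) ^ 2 * (c ^ 3 * ((3 : ℝ) ^ ((3 : ℝ) / 2)) * B) * ‖v‖) * σ ^ (-(3 / 2 : ℝ)) +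
    ((Fintype.card d : ℝ) ^ 2 * (c ^ 3 * cH * ((2 : ℝ) ^ (β / 2) / (3 : ℝ) ^ (β / 2) * (3 : ℝ) ^ ((3 : ℝ) / 2)) * A) * ‖v‖) *
      σ ^ ((β - 3) / 2) with hΘ_def
  have hΘ : ∀ σ, 0 < σ → ‖(Δ (heatExtension (FunctionSpaces.Torus.lift g) σ)) x‖ ≤ Θ σ := by
    intro σ hσ
    have ha : 0 < σ / 3 := by positivity
    have hσa : σ / 3 + σ / 3 + σ / 3 = σ := by ring
    rw [laplacian_heatExtension_lift hg hσ x, hΔg,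
      heatExtension_sum_sum_lift_sub (fun i j => (hF3 i j).continuous) (fun i j => (hG3 i j).continuous) hσ x]
    have hFb : ∀ i j, ‖heatExtension (FunctionSpaces.Torus.lift (F3 i j)) σ x‖ ≤
        c ^ 3 * ((σ / 3) ^ (-(1 / 2 : ℝ))) ^ 3 * B * ‖v‖ := fun i j => by
      have h := norm_heatExtension_lift_lineDeriv₃_le_of_bound (hF i j) (hB i j) ha x v (e i) (e j)
      rw [hσa, he, he, ← hc] at h
      refine h.trans_eq ?_
      ring
    have hGb : ∀ i j, ‖heatExtension (FunctionSpaces.Torus.lift (G3 i j)) σ x‖ ≤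
        c ^ 3 * cH * ((2 * (σ / 3)) ^ (β / 2) * ((σ / 3) ^ (-(1 / 2 : ℝ))) ^ 3) * A * ‖v‖ := fun i j => by
      have h := norm_heatExtension_lift_lineDeriv₃_le_of_holder (hG i j) hA hβ0 hβ1.le (hH i j) ha x v
        (e i) (e j)
      rw [hσa, he, he, ← hc, ← hcH] at h
      refine h.trans_eq ?_
      ring
    calc ‖∑ i, ∑ j, heatExtension (FunctionSpaces.Torus.lift (F3 i j)) σ x -
          ∑ i, ∑ j, heatExtension (FunctionSpaces.Torus.lift (G3 i j)) σ x‖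
        ≤ ∑ i, ∑ j, ‖heatExtension (FunctionSpaces.Torus.lift (F3 i j)) σ x‖ +
          ∑ i, ∑ j, ‖heatExtension (FunctionSpaces.Torus.lift (G3 i j)) σ x‖ := by
          refine (norm_sub_le _ _).trans (add_le_add ?_ ?_) <;>
            exact (norm_sum_le _ _).trans (Finset.sum_le_sum fun i _ => norm_sum_le _ _)
      _ ≤ ∑ _i : d, ∑ _j : d, c ^ 3 * ((σ / 3) ^ (-(1 / 2 : ℝ))) ^ 3 * B * ‖v‖ +
          ∑ _i : d, ∑ _j : d, c ^ 3 * cH * ((2 * (σ / 3)) ^ (β / 2) * ((σ / 3) ^ (-(1 / 2 : ℝ))) ^ 3) * A * ‖v‖ :=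
          add_le_add (Finset.sum_le_sum fun i _ => Finset.sum_le_sum fun j _ => hFb i j)
            (Finset.sum_le_sum fun i _ => Finset.sum_le_sum fun j _ => hGb i j)
      _ = Θ σ := by
          simp only [Finset.sum_const, Finset.card_univ, nsmul_eq_mul, hΘ_def]
          rw [rpow_div_three_aux' hσ β, rpow_div_three_aux hσ]
          ring
  -- integrability and the value of `∫_τ^∞ Θ`
  have hβ3 : (β - 3) / 2 < -1 := by linarith
  have h32 : (-(3 / 2 : ℝ)) < -1 := by norm_num
  have hΘi : IntegrableOn Θ (Ioi τ) :=
    ((integrableOn_Ioi_rpow_of_lt h32 hτ).const_mul _).add ((integrableOn_Ioi_rpow_of_lt hβ3 hτ).const_mul _)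
  have hΘint : ∫ σ in Ioi τ, Θ σ =
      (KF * B * τ ^ (-(1 / 2 : ℝ)) + KG * A * τ ^ ((β - 1) / 2)) * ‖v‖ := by
    rw [hΘ_def, integral_add ((integrableOn_Ioi_rpow_of_lt h32 hτ).const_mul _)
      ((integrableOn_Ioi_rpow_of_lt hβ3 hτ).const_mul _), integral_const_mul, integral_const_mul,
      integral_Ioi_rpow_of_lt h32 hτ, integral_Ioi_rpow_of_lt hβ3 hτ]
    have h1 : -(3 / 2 : ℝ) + 1 = -(1 / 2 : ℝ) := by norm_num
    have h2 : (β - 3) / 2 + 1 = (β - 1) / 2 := by ring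
    have h1β : (1 - β) ≠ 0 := by intro h; linarith
    have h3β : (β - 1) ≠ 0 := by intro h; apply h1β; linarith
    have h4β : (-1 + β) ≠ 0 := by intro h; apply h1β; linarith
    rw [h1, h2]
    rw [show -τ ^ (-(1 / 2 : ℝ)) / (-(1 / 2 : ℝ)) = 2 * τ ^ (-(1 / 2 : ℝ)) by ring,
      show -τ ^ ((β - 1) / 2) / ((β - 1) / 2) = (2 / (1 - β)) * τ ^ ((β - 1) / 2) by
        field_simp
        ring]
    rw [hKF, hKG]
    ring
  rw [← hΘint]
  exact norm_heatExtension_le_integral_Ioi (memLp_top_lift hg.continuous) hτ x hΘi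
    (fun σ hσ => hΘ σ (hτ.trans hσ)) (fun ε hε => eventually_norm_heatExtension_lift_lineDeriv_le hφ x v hε)

end Pressure

end TorusHeat

end Literature.Analysis.FluidPDE
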